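import Summits.AnomalousDissipation.AnomalousDissipation.Theorems.BaireTransferDenseLoudDesignerForcesErgodicLine
import Summits.AnomalousDissipation.AnomalousDissipation.Theorems.MarginalStabilityChainChainRealisationStubLoudOfContrast
import Literature.Analysis.FunctionSpaces.TorusPlanarLift
import HarnessLib

/-!
# Stub `stub_loudOfContrastZM` of the line `SketchIdeator2` (card `separatrix-flux-pinning`)
# (crux `MarginalStabilityChain.ChainRealisation`, stmt-AnomalousDissipation-14249)

Sorry-free discharge of the registered stub `stub_loudOfContrastZM` of the lead's skeleton: the same
**budget step** as the landed `stub_loudOfContrast`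
(`MarginalStabilityChainChainRealisationStubLoudOfContrast`), now for a contrast family whose velocity
slices are MEAN FREE for `t ≥ 0` and whose enstrophy bound holds from `t ≥ 0` (the ergodic phase space of
the line is the mean-zero energy space).  Both extra clauses are carried through verbatim: the family
`ν, u, p` is kept, the force is `f = twoHalf g (μ • h)` (smooth, solenoidal, mean free:
`Torus.IsSmooth.twoHalf`, `Torus.IsDivFree.twoHalf`, `hasZeroMean_twoHalf_smul`), and the loudness
constant is `ε = μ a₀`: by energy equality on `[0, T]` and the forward energy bound the mean dissipation is
the `limsup`-mean of the injected power (`meanDissipation_eq_longTimeAvgSup_inner`, Doering–Foias 2002 §2;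
Robinson–Rodrigo–Sadowski 2016 Thm. 6.5), which splits as `⟨⟪g ∘ π, π_E u⟫⟩ + μ⟨(h ∘ π) u₂⟩ ≥ 0 + μ a₀`
(`mul_le_longTimeAvgSup_inner_twoHalf`).
-/

set_option linter.dupNamespace false

noncomputable section

open MeasureTheory Set Filter Topology
open scoped InnerProductSpace
open Literature.Analysis.FunctionSpaces Literature.Analysis.FunctionSpaces.Torus
open Literature.Analysis.FluidPDE

namespace Summit.AnomalousDissipation.AnomalousDissipation.Theorems.ChainRealisation.SeparatrixFluxPinning

open Summit.AnomalousDissipation.AnomalousDissipation.Theorems.DenseLoudDesignerForces.Ergodic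
open Literature.Analysis.FluidPDE.Torus

/-- Local notation: the torus `T³`. -/
local notation "𝕋³" => UnitAddTorus (Fin 3)
/-- Local notation: velocity values. -/
local notation "E³" => EuclideanSpace ℝ (Fin 3)
/-- Local notation: the planar torus `T²`. -/
local notation "𝕋²" => UnitAddTorus (Fin 2)
/-- Local notation: planar velocity values. -/
local notation "E²" => EuclideanSpace ℝ (Fin 2)

/-- **Stub `stub_loudOfContrastZM` (the budget step of the line `SketchIdeator2`, mean-zero version).**
A contrast family — smooth planar solenoidal mean-free `g`, smooth mean-free axial pattern `h`, amplitude
`μ > 0`, contrast floor `a₀ > 0`, energy ceiling `E`, and along `ν_j → 0` forward classical trajectories on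
`[0, ∞) × T³` for the arena force `twoHalf g (μ • h)` that are enstrophy-bounded and mean free from `t ≥ 0`,
pointwise energy-bounded forward, of mean energy `≤ E`, with non-negative mean planar work and axial
contrast `≥ a₀` — yields a forward-regular mean-free LOUD bounded family for the ONE force
`f = twoHalf g (μ • h)` (smooth, solenoidal, mean free): by energy equality the mean dissipation is the mean
injected power (`meanDissipation_eq_longTimeAvgSup_inner`), which splits as
`⟨⟪g ∘ π, π_E u⟫⟩ + μ⟨(h ∘ π) u₂⟩ ≥ 0 + μ a₀` (`mul_le_longTimeAvgSup_inner_twoHalf`), so `ε = μ a₀ > 0`;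
the enstrophy and mean-zero clauses are passed through unchanged. -/
theorem stub_loudOfContrastZM :
    (∃ (g : 𝕋² → E²) (h : 𝕋² → ℝ) (μ a₀ E : ℝ),
      IsSmooth g ∧ IsDivFree g ∧ HasZeroMean g ∧ IsSmooth h ∧ HasZeroMean h ∧ 0 < μ ∧ 0 < a₀ ∧
      ∃ (ν : ℕ → ℝ) (u : ℕ → ℝ → 𝕋³ → E³) (p : ℕ → ℝ → 𝕋³ → ℝ),
        (∀ j, 0 < ν j) ∧ Tendsto ν atTop (nhds 0) ∧
        (∀ j, IsClassicalNSSolutionOn (Set.Ici 0) (ν j) (fun _ => twoHalf g (μ • h)) (u j) (p j)) ∧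
        (∀ j, ∃ M : ℝ, ∀ t : ℝ, 0 ≤ t → gradNormSq (u j t) ≤ M) ∧
        (∀ j t, 0 ≤ t → HasZeroMean (u j t)) ∧
        (∀ j, ∃ C : ℝ, ∀ t : ℝ, 0 ≤ t → ∫ x, ‖u j t x‖ ^ 2 ≤ C) ∧
        (∀ j, meanEnergy (u j) ≤ E) ∧
        (∀ j, 0 ≤ longTimeAvgInf (fun t => ∫ x, ⟪g (planarProj x), planarProjE (u j t x)⟫_ℝ)) ∧
        (∀ j, a₀ ≤ longTimeAvgSup (fun t => ∫ x, h (planarProj x) * u j t x 2))) →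
    ∃ f : 𝕋³ → E³, IsSmooth f ∧ IsDivFree f ∧ HasZeroMean f ∧
      ∃ (ν : ℕ → ℝ) (u : ℕ → ℝ → 𝕋³ → E³) (p : ℕ → ℝ → 𝕋³ → ℝ),
        (∀ j, 0 < ν j) ∧ Tendsto ν atTop (nhds 0) ∧
        (∀ j, IsClassicalNSSolutionOn (Set.Ici 0) (ν j) (fun _ => f) (u j) (p j)) ∧
        (∀ j, ∃ M : ℝ, ∀ t : ℝ, 0 ≤ t → gradNormSq (u j t) ≤ M) ∧
        (∀ j t, 0 ≤ t → HasZeroMean (u j t)) ∧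
        (∃ E : ℝ, ∀ j, meanEnergy (u j) ≤ E) ∧
        ∃ ε : ℝ, 0 < ε ∧ ∀ j, ε ≤ meanDissipation (ν j) (u j) := by
  rintro ⟨g, h, μ, a₀, E, hg, hdiv, hg0, hh, hh0, hμ, ha₀, ν, u, p, hν, hν0, hsol, hM, hZ, hC, hE, hIg,
    hIh⟩
  have hf : IsSmooth (twoHalf g (μ • h)) := hg.twoHalf (hh.smul μ)
  refine ⟨twoHalf g (μ • h), hf, hdiv.twoHalf _, hasZeroMean_twoHalf_smul hg hh hg0 hh0 μ, ν, u, p, hν,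
    hν0, hsol, hM, hZ, ⟨E, hE⟩, μ * a₀, mul_pos hμ ha₀, fun j => ?_⟩
  obtain ⟨C, hCj⟩ := hC j
  rw [meanDissipation_eq_longTimeAvgSup_inner (hsol j) hf hCj]
  exact mul_le_longTimeAvgSup_inner_twoHalf hg hh hμ.le (hsol j).smooth_velocity hCj (hIg j) (hIh j)

end Summit.AnomalousDissipation.AnomalousDissipation.Theorems.ChainRealisation.SeparatrixFluxPinning

end
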